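import Summits.AtomisticToContinuum.BoseEinsteinCondensation.Theses.BECDyadicChaining
import HarnessLib

/-!
# Crux `DyadicCoherenceDefect` (stmt-AtomisticToContinuum-13192), line `registered`:
# the registered stub `stub_freeAssembly` (D, the FREE-GAS ASSEMBLY)

Supports (does not close) stmt-AtomisticToContinuum-13192.  Pure bookkeeping: the four free-gas
stubs of the line, taken as hypotheses in expanded form —

* G (free Dirichlet gap): `3Nπ²/L² + c ‖Ψ − ⟨Ψ₀,Ψ⟩Ψ₀‖² ≤ energy 0 Ψ` with `c = c(N, L) > 0`,
* U (free energy from above): `E₀(0, N, L) ≤ 3Nπ²/L²`,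
* D1 (zero scattering length means no interaction): `energy v Ψ = energy 0 Ψ`,
* DP (defect perturbation): `A_m(Ψ) ≤ A_{m-1}(Ψ) + 2 √(N ‖Ψ − αΨ₀‖²)` for every `α ∈ ℂ`,

give the free-gas case of the crux: for `a(v) = 0`, EVERY density `ρ > 0` and every bracket base
`ℓ_d > 0`, the budget `β_j = 2^{-j}/16` (`Σ_j β_j = 1/8`) controls the per-level coherence
defect of near-minimisers, `A_m ≤ A_{m-1} + β_j √N` whenever `L/2^m ∈ [ℓ_d 2^j, ℓ_d 2^{j+1})`.

Proof.  For `N ≥ 1` put `L = (N/ρ)^{1/3} > 0`, take `c > 0` from G, the bracket ceiling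
`J = ⌈L/ℓ_d⌉₊` (an occurring bracket has `j < 2^j ≤ L/ℓ_d`, so `j ≤ J` and `β_J ≤ β_j`) and the
tolerance `δ = c s²` with `s = β_J/2`.  For a `δ`-near-minimiser `Ψ`, D1 replaces `energy v`,
`E₀(v)` by `energy 0`, `E₀(0)`; by U and G,
`3Nπ²/L² + c ‖W‖² ≤ energy 0 Ψ ≤ 3Nπ²/L² + c s²` (`W = Ψ − ⟨Ψ₀,Ψ⟩Ψ₀`), so `‖W‖² ≤ s²`
(cancel the finite constant, then `c ∈ (0, ∞)`), and DP with `α = ⟨Ψ₀, Ψ⟩` gives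
`A_m ≤ A_{m-1} + 2 √(N s²) = A_{m-1} + β_J √N ≤ A_{m-1} + β_j √N`.  No new definitions.
-/

noncomputable section

open Filter MeasureTheory
open scoped ENNReal NNReal BigOperators

namespace Summit.AtomisticToContinuum.BoseEinsteinCondensation.Cruxes.DyadicCoherenceDefect.Birth

open Literature.MathematicalPhysics.QuantumManyBody.BoseGas
open Summit.AtomisticToContinuum.BoseEinsteinCondensation.Theses

namespace StubFreeAssembly

/-! ### Bookkeeping lemmas (budget, bracket ceiling, `ℝ≥0∞` algebra) -/

/-- The budget `β_j = 2^{-j}/16` sums to `1/8`. [folklore] -/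
theorem tsum_budget : ∑' j : ℕ, (1 / 2 : ℝ) ^ j / 16 = 1 / 8 := by
  rw [tsum_div_const, tsum_geometric_two]
  norm_num

/-- The budget `β_j = 2^{-j}/16` is antitone in the bracket index. [folklore] -/
theorem budget_antitone {j J : ℕ} (h : j ≤ J) :
    (1 / 2 : ℝ) ^ J / 16 ≤ (1 / 2 : ℝ) ^ j / 16 :=
  div_le_div_of_nonneg_right (pow_le_pow_of_le_one (by norm_num) (by norm_num) h) (by norm_num)

/-- Every occurring bracket index is below the ceiling `⌈L/ℓ_d⌉₊`: from `ℓ_d 2^j ≤ L/2^m ≤ L`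
one gets `j < 2^j ≤ L/ℓ_d`. [folklore] -/
theorem bracket_le_ceil {ℓd L : ℝ} {m j : ℕ} (hℓd : 0 < ℓd) (hL : 0 ≤ L)
    (h : ℓd * 2 ^ j ≤ L / 2 ^ m) : j ≤ ⌈L / ℓd⌉₊ := by
  have h1 : L / 2 ^ m ≤ L := div_le_self hL (one_le_pow₀ one_le_two)
  have h2 : (2 : ℝ) ^ j ≤ L / ℓd := by
    rw [le_div_iff₀ hℓd, mul_comm]
    exact h.trans h1
  have h3 : (j : ℝ) < 2 ^ j := by exact_mod_cast Nat.lt_two_pow_self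
  exact_mod_cast (h3.le.trans h2).trans (Nat.le_ceil _)

/-- Doubling half a budget in `ℝ≥0∞`: `2 · ofReal (b/2) ≤ ofReal b'` for `0 ≤ b ≤ b'`.
[folklore] -/
theorem two_mul_ofReal_half_le {b b' : ℝ} (hb : 0 ≤ b) (h : b ≤ b') :
    2 * ENNReal.ofReal (b / 2) ≤ ENNReal.ofReal b' := by
  rw [two_mul, ← ENNReal.ofReal_add (by positivity) (by positivity), add_halves]
  exact ENNReal.ofReal_le_ofReal h

/-- The per-level step in `ℝ≥0∞`: `A_m ≤ A_{m-1} + 2 √(N I)`, `I ≤ s²` and `2 s ≤ t` give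
`A_m ≤ A_{m-1} + t √N`. [folklore] -/
theorem level_bound {Am Am1 N I s t : ℝ≥0∞} (hP : Am ≤ Am1 + 2 * (N * I) ^ (1 / 2 : ℝ))
    (hI : I ≤ s ^ (2 : ℝ)) (hst : 2 * s ≤ t) : Am ≤ Am1 + t * N ^ (1 / 2 : ℝ) := by
  have key : 2 * (N * I) ^ (1 / 2 : ℝ) ≤ t * N ^ (1 / 2 : ℝ) :=
    calc 2 * (N * I) ^ (1 / 2 : ℝ) ≤ 2 * (N * s ^ (2 : ℝ)) ^ (1 / 2 : ℝ) := by gcongr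
      _ = 2 * s * N ^ (1 / 2 : ℝ) := by
        rw [ENNReal.mul_rpow_of_nonneg _ _ (by norm_num : (0 : ℝ) ≤ 1 / 2), ← ENNReal.rpow_mul,
          show (2 : ℝ) * (1 / 2) = 1 by norm_num, ENNReal.rpow_one]
        ring
      _ ≤ t * N ^ (1 / 2 : ℝ) := by gcongr
  exact hP.trans (add_le_add_right key Am1)

end StubFreeAssembly

open StubFreeAssembly in
/-- **Stub D (M/L): free-gas assembly** — the free Dirichlet gap (G), the free energy bound (U),
"zero scattering length means no interaction" (D1) and the defect-perturbation lemma (DP), all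
four as hypotheses in expanded form, give the FREE-GAS CASE of the crux: for `a(v) = 0`, every
`ρ > 0` and every bracket base `ℓ_d > 0`, with the budget `β_j = 2^{-j}/16` (`Σ β = 1/8`), for
`N ≥ 1` and `δ = c (β_J/2)²` (`J = ⌈L/ℓ_d⌉₊`, `c` the gap constant of G), every `δ`-near-minimiser
has per-level coherence defect `A_m − A_{m-1} ≤ β_j √N` in every bracket `j`. [folklore] -/
theorem stub_freeAssembly :
    (∀ (N : ℕ) (L : ℝ), 1 ≤ N → 0 < L → ∃ c : ℝ, 0 < c ∧ ∀ Ψ : TrialState N L,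
      let Ψ₀ : Config N → ℂ := fun X => (boxN N L).indicator
        (fun X => ∏ i : Fin N, ∏ k : Fin 3, ((Real.sqrt (2 / L) * Real.sin (Real.pi * X i k / L) : ℝ) : ℂ)) X
      ENNReal.ofReal (3 * N * Real.pi ^ 2 / L ^ 2) +
          ENNReal.ofReal c * ∫⁻ X, (‖Ψ.ψ X - (∫ Y, (starRingEnd ℂ) (Ψ₀ Y) * Ψ.ψ Y) * Ψ₀ X‖₊ : ℝ≥0∞) ^ 2 ≤
        energy 0 Ψ) →
    (∀ (N : ℕ) (L : ℝ), 1 ≤ N → 0 < L →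
      groundStateEnergy 0 N L ≤ ENNReal.ofReal (3 * N * Real.pi ^ 2 / L ^ 2)) →
    (∀ v : ℝ → ℝ≥0∞, IsRepulsiveFiniteRange v → scatteringLength v = 0 →
      ∀ (N : ℕ) (L : ℝ) (Ψ : TrialState N L), energy v Ψ = energy 0 Ψ) →
    (∀ (N : ℕ) (L : ℝ), 0 < L → ∀ (Ψ : TrialState N L) (α : ℂ) (m : ℕ), 1 ≤ m →
      let Ψ₀ : Config N → ℂ := fun X => (boxN N L).indicator
        (fun X => ∏ i : Fin N, ∏ k : Fin 3, ((Real.sqrt (2 / L) * Real.sin (Real.pi * X i k / L) : ℝ) : ℂ)) X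
      let φ : (m : ℕ) → (Fin 3 → Fin (2 ^ m)) → EuclideanSpace ℝ (Fin 3) → ℂ := fun m i =>
        Set.indicator {x : EuclideanSpace ℝ (Fin 3) | ∀ k : Fin 3, x k ∈
            Set.Ioo (((i k : ℕ) : ℝ) * (L / 2 ^ m)) ((((i k : ℕ) : ℝ) + 1) * (L / 2 ^ m))}
          (fun _ => ((Real.sqrt ((L / 2 ^ m) ^ 3))⁻¹ : ℂ))
      let A : ℕ → ℝ≥0∞ := fun m => (8 : ℝ≥0∞) ^ (-(m : ℝ) / 2) *
        ∑ i : Fin 3 → Fin (2 ^ m), (occupation N (φ m i) Ψ.ψ) ^ (1 / 2 : ℝ)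
      A m ≤ A (m - 1) + 2 * ((N : ℝ≥0∞) * ∫⁻ X, (‖Ψ.ψ X - α * Ψ₀ X‖₊ : ℝ≥0∞) ^ 2) ^ (1 / 2 : ℝ)) →
    ∀ v : ℝ → ℝ≥0∞, IsRepulsiveFiniteRange v → scatteringLength v = 0 → ∀ ℓd : ℝ, 0 < ℓd →
      ∀ ρ : ℝ, 0 < ρ →
        ∃ β : ℕ → ℝ, (∀ j, 0 ≤ β j) ∧ Summable β ∧ ∑' j, β j ≤ 1 / 8 ∧ ∀ᶠ N : ℕ in atTop,
          let L : ℝ := sideLength ρ N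
          let φ : (m : ℕ) → (Fin 3 → Fin (2 ^ m)) → EuclideanSpace ℝ (Fin 3) → ℂ := fun m i =>
            Set.indicator {x : EuclideanSpace ℝ (Fin 3) | ∀ k : Fin 3, x k ∈
                Set.Ioo (((i k : ℕ) : ℝ) * (L / 2 ^ m)) ((((i k : ℕ) : ℝ) + 1) * (L / 2 ^ m))}
              (fun _ => ((Real.sqrt ((L / 2 ^ m) ^ 3))⁻¹ : ℂ))
          ∃ δ : ℝ≥0∞, 0 < δ ∧ ∀ Ψ : TrialState N L, energy v Ψ ≤ groundStateEnergy v N L + δ →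
            let A : ℕ → ℝ≥0∞ := fun m => (8 : ℝ≥0∞) ^ (-(m : ℝ) / 2) *
              ∑ i : Fin 3 → Fin (2 ^ m), (occupation N (φ m i) Ψ.ψ) ^ (1 / 2 : ℝ)
            ∀ m j : ℕ, 1 ≤ m → ℓd * 2 ^ j ≤ L / 2 ^ m → L / 2 ^ m < ℓd * 2 ^ (j + 1) →
              A m ≤ A (m - 1) + ENNReal.ofReal (β j) * (N : ℝ≥0∞) ^ (1 / 2 : ℝ) := by
  intro hG hU hD1 hDP v hv h0 ℓd hℓd ρ hρ
  refine ⟨fun j => (1 / 2 : ℝ) ^ j / 16, fun j => by positivity,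
    summable_geometric_two.div_const 16, tsum_budget.le, ?_⟩
  filter_upwards [eventually_ge_atTop 1] with N hN
  have hL : 0 < sideLength ρ N := Real.rpow_pos_of_pos (div_pos (Nat.cast_pos.2 hN) hρ) _
  dsimp only
  generalize sideLength ρ N = L at hL ⊢
  obtain ⟨c, hc, HG⟩ := hG N L hN hL
  have hc0 : ENNReal.ofReal c ≠ 0 := (ENNReal.ofReal_pos.2 hc).ne'
  -- the budget at the bracket ceiling `J = ⌈L/ℓd⌉₊` and the tolerance `δ = c s²`, `s = β_J / 2`
  have hb : 0 < (1 / 2 : ℝ) ^ ⌈L / ℓd⌉₊ / 16 := by positivity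
  have hs : 0 < ENNReal.ofReal ((1 / 2 : ℝ) ^ ⌈L / ℓd⌉₊ / 16 / 2) :=
    ENNReal.ofReal_pos.2 (by positivity)
  refine ⟨ENNReal.ofReal c * ENNReal.ofReal ((1 / 2 : ℝ) ^ ⌈L / ℓd⌉₊ / 16 / 2) ^ (2 : ℝ),
    ENNReal.mul_pos hc0 (ENNReal.rpow_pos hs ENNReal.ofReal_ne_top).ne', fun Ψ hΨ => ?_⟩
  intro m j hm hj1 _
  -- energies: `a = 0` removes the interaction (D1); U and G then squeeze `c ‖W‖² ≤ δ = c s²`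
  rw [hD1 v hv h0 N L Ψ, show groundStateEnergy v N L = groundStateEnergy 0 N L from
    iInf_congr fun Φ => hD1 v hv h0 N L Φ] at hΨ
  have HGΨ := HG Ψ
  dsimp only at HGΨ
  have hW := (ENNReal.mul_le_mul_iff_right hc0 ENNReal.ofReal_ne_top).mp
    ((ENNReal.add_le_add_iff_left ENNReal.ofReal_ne_top).mp
      (HGΨ.trans (hΨ.trans (add_le_add_left (hU N L hN hL) _))))
  -- the level step: DP with `α = ⟨Ψ₀, Ψ⟩`, then `2 √(N s²) = β_J √N ≤ β_j √N` since `j ≤ J`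
  have hP := hDP N L hL Ψ (∫ Y, (starRingEnd ℂ) ((boxN N L).indicator
    (fun X => ∏ i : Fin N, ∏ k : Fin 3,
      ((Real.sqrt (2 / L) * Real.sin (Real.pi * X i k / L) : ℝ) : ℂ)) Y) * Ψ.ψ Y) m hm
  dsimp only at hP
  exact level_bound hP hW (two_mul_ofReal_half_le hb.le
    (budget_antitone (bracket_le_ceil hℓd hL.le hj1)))

end Summit.AtomisticToContinuum.BoseEinsteinCondensation.Cruxes.DyadicCoherenceDefect.Birth

end
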